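import Mathlib
import Summits.AtomisticToContinuum.HydrodynamicLimit.Theses.OneFlightGossipEngine

/-!
# GossipStressIdentity — exact gossip closure of traceless second moments

Proof of the support item `GossipStressIdentity` (stmt-AtomisticToContinuum-9533) of route
`OneFlightGossipEngine`: along an exogenous pair schedule with independent, mean-zero, isotropic
unit kicks, the expected traceless quadratic form `Σ_k (⟪c_k,e⟫² − ‖c_k‖²‖e‖²/3)` of the
post-schedule velocities equals the same form at the gossip-averaged velocities.

Proof: generalise to matrix-weighted forms `Σ_k Q_e(Σ_a W k a • c a)`, peel the last kick of the
schedule (`List.finRange_succ_last`), split `Measure.pi ν` over `Fin (m+1)` into the last factor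
times the rest (`measurePreserving_piFinSuccAbove`), integrate the last kick with the one-step
identity `∫ Q_e(a + β ω) dν = Q_e(a)` (mean zero + isotropy + unit norm), and conclude by the
induction hypothesis applied to the weights averaged by the (symmetric) gossip matrix.
-/

open MeasureTheory

namespace Summit.AtomisticToContinuum.HydrodynamicLimit.Theorems

open Literature.MathematicalPhysics.KineticTheory (V3)

/-- A continuous function is integrable against a finite measure carried (a.e.) by a compact set. -/
theorem gossip_integrable_of_ae_mem_compact {X E : Type*} [TopologicalSpace X] [MeasurableSpace X]
    [OpensMeasurableSpace X] [T2Space X] [NormedAddCommGroup E] {μ : Measure X} [IsFiniteMeasure μ]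
    {K : Set X} (hK : IsCompact K) (hμ : ∀ᵐ x ∂μ, x ∈ K) {f : X → E} (hf : Continuous f) :
    Integrable f μ := by
  have h := hf.continuousOn.integrableOn_compact (μ := μ) hK
  rwa [IntegrableOn, Measure.restrict_eq_self_of_ae_mem hμ] at h

/-- Under a product of probability measures carried by the unit sphere, a.e. every coordinate lies
on the unit sphere. -/
theorem gossip_ae_pi_sphere {m : ℕ} (ν : Fin m → Measure V3)
    (hprob : ∀ t, IsProbabilityMeasure (ν t)) (h1 : ∀ t, ∀ᵐ ω ∂(ν t), ‖ω‖ = 1) :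
    ∀ᵐ ωs ∂(Measure.pi ν), ωs ∈ Set.univ.pi (fun _ : Fin m => Metric.sphere (0 : V3) 1) := by
  have : ∀ t, ∀ᵐ ωs ∂(Measure.pi ν), ‖ωs t‖ = 1 := fun t =>
    (Measure.tendsto_eval_ae_ae (μ := ν) (i := t)).eventually (h1 t)
  filter_upwards [ae_all_iff.2 this] with ωs h
  simpa [Set.mem_univ_pi] using h

/-- One isotropic kick preserves the traceless quadratic form in expectation:
`∫ (⟪a + β ω, e⟫² − ‖a + β ω‖² ‖e‖² / 3) dν(ω) = ⟪a, e⟫² − ‖a‖² ‖e‖² / 3`. -/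
theorem gossip_oneStep (ν : Measure V3) (hprob : IsProbabilityMeasure ν) (h1 : ∀ᵐ ω ∂ν, ‖ω‖ = 1)
    (h0 : ∫ ω, ω ∂ν = 0) (e : V3) (h2 : ∫ ω, (inner ℝ ω e) ^ 2 ∂ν = ‖e‖ ^ 2 / 3)
    (a : V3) (β : ℝ) :
    ∫ ω, ((inner ℝ (a + β • ω) e) ^ 2 - ‖a + β • ω‖ ^ 2 * ‖e‖ ^ 2 / 3) ∂ν
      = (inner ℝ a e) ^ 2 - ‖a‖ ^ 2 * ‖e‖ ^ 2 / 3 := by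
  have hK : ∀ᵐ ω ∂ν, ω ∈ Metric.sphere (0 : V3) 1 := by
    filter_upwards [h1] with ω hω
    simpa using hω
  have hint : ∀ {E : Type} [NormedAddCommGroup E] {f : V3 → E}, Continuous f → Integrable f ν :=
    fun hf => gossip_integrable_of_ae_mem_compact (isCompact_sphere 0 1) hK hf
  have hexp : ∀ᵐ ω ∂ν, (inner ℝ (a + β • ω) e) ^ 2 - ‖a + β • ω‖ ^ 2 * ‖e‖ ^ 2 / 3
      = ((inner ℝ a e) ^ 2 - ‖a‖ ^ 2 * ‖e‖ ^ 2 / 3 - β ^ 2 * ‖e‖ ^ 2 / 3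
        + (2 * β * inner ℝ a e) * inner ℝ e ω - (2 * β * ‖e‖ ^ 2 / 3) * inner ℝ a ω)
        + β ^ 2 * (inner ℝ ω e) ^ 2 := by
    filter_upwards [h1] with ω hω
    have h3 : ‖a + β • ω‖ ^ 2 = ‖a‖ ^ 2 + 2 * β * inner ℝ a ω + β ^ 2 := by
      rw [norm_add_sq_real, norm_smul, mul_pow, Real.norm_eq_abs, sq_abs, hω, real_inner_smul_right]
      ring
    rw [h3, inner_add_left, real_inner_smul_left, real_inner_comm e ω]
    ring
  rw [integral_congr_ae hexp]
  have iA : Integrable (fun ω : V3 => (inner ℝ a e) ^ 2 - ‖a‖ ^ 2 * ‖e‖ ^ 2 / 3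
      - β ^ 2 * ‖e‖ ^ 2 / 3 + (2 * β * inner ℝ a e) * inner ℝ e ω
      - (2 * β * ‖e‖ ^ 2 / 3) * inner ℝ a ω) ν := hint (by fun_prop)
  have iB : Integrable (fun ω : V3 => β ^ 2 * (inner ℝ ω e) ^ 2) ν := hint (by fun_prop)
  have iC : Integrable (fun ω : V3 => (inner ℝ a e) ^ 2 - ‖a‖ ^ 2 * ‖e‖ ^ 2 / 3
      - β ^ 2 * ‖e‖ ^ 2 / 3 + (2 * β * inner ℝ a e) * inner ℝ e ω) ν := hint (by fun_prop)
  have iD : Integrable (fun ω : V3 => (2 * β * ‖e‖ ^ 2 / 3) * inner ℝ a ω) ν := hint (by fun_prop)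
  have iE : Integrable (fun ω : V3 => (inner ℝ a e) ^ 2 - ‖a‖ ^ 2 * ‖e‖ ^ 2 / 3
      - β ^ 2 * ‖e‖ ^ 2 / 3) ν := hint (by fun_prop)
  have iF : Integrable (fun ω : V3 => (2 * β * inner ℝ a e) * inner ℝ e ω) ν := hint (by fun_prop)
  have hid : Integrable (fun ω : V3 => ω) ν := hint continuous_id
  have hme : ∫ ω, inner ℝ e ω ∂ν = 0 := by
    rw [integral_inner hid e, h0, inner_zero_right]
  have hma : ∫ ω, inner ℝ a ω ∂ν = 0 := by
    rw [integral_inner hid a, h0, inner_zero_right]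
  rw [integral_add iA iB, integral_sub iC iD, integral_add iE iF, integral_const_mul,
    integral_const_mul, integral_const_mul, hme, hma, h2, integral_const]
  simp only [probReal_univ, smul_eq_mul, one_mul, mul_zero, add_zero, sub_zero]
  ring

/-- Splitting off the last coordinate of `Measure.pi ν` over `Fin (m+1) → V3` (Fubini). -/
theorem gossip_pi_succ_integral {m : ℕ} (ν : Fin (m + 1) → Measure V3)
    (hprob : ∀ t, IsProbabilityMeasure (ν t)) (Φ : (Fin (m + 1) → V3) → ℝ)
    (hΦ : Integrable Φ (Measure.pi ν)) :
    ∫ ωs, Φ ωs ∂(Measure.pi ν)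
      = ∫ r, ∫ ω, Φ (Fin.snoc r ω) ∂(ν (Fin.last m)) ∂(Measure.pi fun j => ν (Fin.castSucc j)) := by
  have hMP := measurePreserving_piFinSuccAbove ν (Fin.last m)
  rw [Fin.succAbove_last] at hMP
  have hI : Integrable (Φ ∘ (MeasurableEquiv.piFinSuccAbove (fun _ => V3) (Fin.last m)).symm)
      ((ν (Fin.last m)).prod (Measure.pi fun j => ν (Fin.castSucc j))) :=
    (hMP.symm.integrable_comp_emb
      (MeasurableEquiv.piFinSuccAbove (fun _ => V3) (Fin.last m)).symm.measurableEmbedding).2 hΦ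
  have hI' : Integrable
      (fun p => Φ ((MeasurableEquiv.piFinSuccAbove (fun _ => V3) (Fin.last m)).symm p))
      ((ν (Fin.last m)).prod (Measure.pi fun j => ν (Fin.castSucc j))) := hI
  rw [← hMP.symm.integral_comp' Φ, integral_prod_symm _ hI']
  refine integral_congr_ae (Filter.Eventually.of_forall fun r => ?_)
  refine integral_congr_ae (Filter.Eventually.of_forall fun ω => ?_)
  simp only [MeasurableEquiv.piFinSuccAbove_symm_apply, Fin.insertNthEquiv_last]
  rfl

/-- Continuity of the kick-driven fold in (initial datum, kicks). -/
theorem gossip_continuous_foldl {n m : ℕ} (K : (Fin n → V3) → Fin n × Fin n → V3 → (Fin n → V3))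
    (hKc : ∀ ij, Continuous fun p : (Fin n → V3) × V3 => K p.1 ij p.2) (s : Fin m → Fin n × Fin n) :
    ∀ L : List (Fin m),
      Continuous fun p : (Fin n → V3) × (Fin m → V3) => L.foldl (fun x t => K x (s t) (p.2 t)) p.1
  | [] => by simpa using continuous_fst
  | t :: L => by
    have ih := gossip_continuous_foldl K hKc s L
    have hstep : Continuous fun p : (Fin n → V3) × (Fin m → V3) => (K p.1 (s t) (p.2 t), p.2) :=
      ((hKc (s t)).comp (continuous_fst.prodMk ((continuous_apply t).comp continuous_snd))).prodMk
        continuous_snd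
    simp only [List.foldl_cons]
    exact ih.comp hstep

/-- The generic induction: for an abstract kick map `K`, averaging map `A`, kick coefficient `B`,
weight-averaging map `T` and a continuous one-kick-invariant functional `F`, the expectation of
`Σ_k F (Σ_a W k a • (kicked fold) a)` over the product kick law equals the same expression at the
averaged fold. -/
theorem gossip_generic {n : ℕ} (F : V3 → ℝ) (hFc : Continuous F)
    (K : (Fin n → V3) → Fin n × Fin n → V3 → (Fin n → V3))
    (A : (Fin n → V3) → Fin n × Fin n → (Fin n → V3))
    (B : (Fin n → ℝ) → (Fin n → V3) → Fin n × Fin n → ℝ)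
    (T : (Fin n → ℝ) → Fin n × Fin n → (Fin n → ℝ))
    (hKc : ∀ ij, Continuous fun p : (Fin n → V3) × V3 => K p.1 ij p.2)
    (hKA : ∀ (γ : Fin n → ℝ) (x : Fin n → V3) (ij : Fin n × Fin n) (ω : V3),
      ∑ a, γ a • K x ij ω a = ∑ a, γ a • A x ij a + B γ x ij • ω)
    (hAT : ∀ (γ : Fin n → ℝ) (x : Fin n → V3) (ij : Fin n × Fin n),
      ∑ a, γ a • A x ij a = ∑ a, T γ ij a • x a) :
    ∀ (m : ℕ) (s : Fin m → Fin n × Fin n) (ν : Fin m → Measure V3),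
      (∀ t, IsProbabilityMeasure (ν t)) → (∀ t, ∀ᵐ ω ∂(ν t), ‖ω‖ = 1) →
      (∀ t (a : V3) (β : ℝ), ∫ ω, F (a + β • ω) ∂(ν t) = F a) →
      ∀ (W : Fin n → Fin n → ℝ) (c : Fin n → V3),
        ∫ ωs, (∑ k, F (∑ a, W k a • (List.finRange m).foldl (fun x t => K x (s t) (ωs t)) c a))
            ∂(Measure.pi ν)
          = ∑ k, F (∑ a, W k a • (List.finRange m).foldl (fun x t => A x (s t)) c a) := by
  intro m
  induction m with
  | zero =>
    intro s ν hprob h1 hF W c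
    simp [List.finRange_zero]
  | succ m ih =>
    intro s ν hprob h1 hF W c
    -- integrability of the full integrand
    have hcont : Continuous fun ωs : Fin (m + 1) → V3 =>
        ∑ k, F (∑ a, W k a • (List.finRange (m + 1)).foldl (fun x t => K x (s t) (ωs t)) c a) := by
      have hfold := (gossip_continuous_foldl K hKc s (List.finRange (m + 1))).comp
        (continuous_const.prodMk continuous_id : Continuous fun ωs : Fin (m + 1) → V3 => (c, ωs))
      refine continuous_finsetSum _ fun k _ => hFc.comp ?_
      refine continuous_finsetSum _ fun a _ => ?_
      exact ((continuous_apply a).comp hfold).const_smul (W k a)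
    have hInt := gossip_integrable_of_ae_mem_compact
      (isCompact_univ_pi fun _ : Fin (m + 1) => isCompact_sphere (0 : V3) 1)
      (gossip_ae_pi_sphere ν hprob h1) hcont
    rw [gossip_pi_succ_integral ν hprob _ hInt]
    -- peel the last kick
    simp only [List.finRange_succ_last, List.foldl_append, List.foldl_cons, List.foldl_nil,
      List.foldl_map, Fin.snoc_castSucc, Fin.snoc_last]
    -- integrate the last kick
    have hKint : ∀ (a : V3) (β : ℝ), Integrable (fun ω : V3 => F (a + β • ω)) (ν (Fin.last m)) := by
      intro a β
      have hK : ∀ᵐ ω ∂(ν (Fin.last m)), ω ∈ Metric.sphere (0 : V3) 1 := by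
        filter_upwards [h1 (Fin.last m)] with ω hω
        simpa using hω
      exact gossip_integrable_of_ae_mem_compact (isCompact_sphere 0 1) hK (by fun_prop)
    have hstep : ∀ X : Fin n → V3,
        ∫ ω, ∑ k, F (∑ a, W k a • K X (s (Fin.last m)) ω a) ∂(ν (Fin.last m))
          = ∑ k, F (∑ a, W k a • A X (s (Fin.last m)) a) := by
      intro X
      simp only [hKA]
      rw [integral_finsetSum _ (fun k _ => hKint _ _)]
      exact Finset.sum_congr rfl fun k _ => hF _ _ _
    simp only [hstep, hAT]
    exact ih (fun t => s (Fin.castSucc t)) (fun j => ν (Fin.castSucc j)) (fun t => hprob _)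
      (fun t => h1 _) (fun t => hF _) (fun k a => T (W k) (s (Fin.last m)) a) c

/-- Continuity of the concrete Kac kick map in (velocities, kick). -/
theorem gossip_kick_continuous {n : ℕ} (ij : Fin n × Fin n) :
    Continuous fun p : (Fin n → V3) × V3 => fun k : Fin n =>
      if k = ij.1 then (1 / 2 : ℝ) • (p.1 ij.1 + p.1 ij.2) + (‖p.1 ij.1 - p.1 ij.2‖ / 2) • p.2
      else if k = ij.2 then (1 / 2 : ℝ) • (p.1 ij.1 + p.1 ij.2) - (‖p.1 ij.1 - p.1 ij.2‖ / 2) • p.2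
      else p.1 k := by
  refine continuous_pi fun k => ?_
  split_ifs <;> fun_prop

/-- The kick map is the gossip average plus a scalar multiple of the kick, row by row. -/
theorem gossip_kick_decomp {n : ℕ} (γ : Fin n → ℝ) (x : Fin n → V3) (ij : Fin n × Fin n) (ω : V3) :
    ∑ a, γ a • (if a = ij.1 then (1 / 2 : ℝ) • (x ij.1 + x ij.2) + (‖x ij.1 - x ij.2‖ / 2) • ω
        else if a = ij.2 then (1 / 2 : ℝ) • (x ij.1 + x ij.2) - (‖x ij.1 - x ij.2‖ / 2) • ω
        else x a)
      = ∑ a, γ a • (if a = ij.1 ∨ a = ij.2 then (1 / 2 : ℝ) • (x ij.1 + x ij.2) else x a)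
        + (∑ a, γ a * (if a = ij.1 then ‖x ij.1 - x ij.2‖ / 2
            else if a = ij.2 then -(‖x ij.1 - x ij.2‖ / 2) else 0)) • ω := by
  rw [Finset.sum_smul, ← Finset.sum_add_distrib]
  refine Finset.sum_congr rfl fun a _ => ?_
  by_cases ha : a = ij.1
  · rw [if_pos ha, if_pos (Or.inl ha), if_pos ha]
    module
  · by_cases hb : a = ij.2
    · rw [if_neg ha, if_pos hb, if_pos (Or.inr hb), if_neg ha, if_pos hb]
      module
    · rw [if_neg ha, if_neg hb, if_neg (not_or.mpr ⟨ha, hb⟩), if_neg ha, if_neg hb]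
      module

/-- The gossip averaging matrix is symmetric: averaging the velocities under a weight vector is
the same as averaging the weights. -/
theorem gossip_avg_transpose {n : ℕ} (γ : Fin n → ℝ) (x : Fin n → V3) (ij : Fin n × Fin n) :
    ∑ a, γ a • (if a = ij.1 ∨ a = ij.2 then (1 / 2 : ℝ) • (x ij.1 + x ij.2) else x a)
      = ∑ a, (if a = ij.1 ∨ a = ij.2 then (1 / 2 : ℝ) * (γ ij.1 + γ ij.2) else γ a) • x a := by
  rcases ij with ⟨i, j⟩
  dsimp only
  by_cases hij : i = j
  · subst hij
    refine Finset.sum_congr rfl fun a _ => ?_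
    by_cases ha : a = i
    · subst ha
      rw [if_pos (Or.inl rfl), if_pos (Or.inl rfl)]
      module
    · rw [if_neg (not_or.mpr ⟨ha, ha⟩), if_neg (not_or.mpr ⟨ha, ha⟩)]
  · rw [← sub_eq_zero, ← Finset.sum_sub_distrib, Finset.sum_eq_add i j hij]
    · rw [if_pos (Or.inl rfl), if_pos (Or.inl rfl), if_pos (Or.inr rfl), if_pos (Or.inr rfl)]
      module
    · intro c _ hc
      rw [if_neg (not_or.mpr hc), if_neg (not_or.mpr hc), sub_self]
    · simp
    · simp

/-- **GossipStressIdentity** (item stmt-AtomisticToContinuum-9533): exact gossip closure of the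
traceless second moments under Kac/hard-sphere kinematics with independent mean-zero isotropic
unit kicks along an exogenous schedule. -/
theorem gossipStressIdentity_proof :
    Summit.AtomisticToContinuum.HydrodynamicLimit.Theses.OneFlightGossipEngine.GossipStressIdentity :=
  by
  unfold
    Summit.AtomisticToContinuum.HydrodynamicLimit.Theses.OneFlightGossipEngine.GossipStressIdentity
  intro n m s _hs ν hprob h1 h0 h2 c e
  have H := gossip_generic (n := n) (fun u : V3 => (inner ℝ u e) ^ 2 - ‖u‖ ^ 2 * ‖e‖ ^ 2 / 3)
    (by fun_prop)
    (fun x ij ω => fun k =>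
      if k = ij.1 then (1 / 2 : ℝ) • (x ij.1 + x ij.2) + (‖x ij.1 - x ij.2‖ / 2) • ω
      else if k = ij.2 then (1 / 2 : ℝ) • (x ij.1 + x ij.2) - (‖x ij.1 - x ij.2‖ / 2) • ω else x k)
    (fun x ij => fun k => if k = ij.1 ∨ k = ij.2 then (1 / 2 : ℝ) • (x ij.1 + x ij.2) else x k)
    (fun γ x ij => ∑ a, γ a * (if a = ij.1 then ‖x ij.1 - x ij.2‖ / 2
      else if a = ij.2 then -(‖x ij.1 - x ij.2‖ / 2) else 0))
    (fun γ ij => fun a => if a = ij.1 ∨ a = ij.2 then (1 / 2 : ℝ) * (γ ij.1 + γ ij.2) else γ a)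
    gossip_kick_continuous gossip_kick_decomp gossip_avg_transpose
    m s ν hprob h1 (fun t a β => gossip_oneStep (ν t) (hprob t) (h1 t) (h0 t) e (h2 t e) a β)
    (fun k a => if a = k then (1 : ℝ) else 0) c
  simp only [ite_smul, one_smul, zero_smul, Finset.sum_ite_eq', Finset.mem_univ, if_true] at H
  exact H

end Summit.AtomisticToContinuum.HydrodynamicLimit.Theorems
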